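import Mathlib
import Summits.AtomisticToContinuum.Crystallization.Theses.PhononSlackCertificates
import Summits.AtomisticToContinuum.Crystallization.Theorems.PhononSlackCertificatesNearFarGlueRStableCoreReduction
import Literature.MathematicalPhysics.StatisticalMechanics.LennardJonesClusters
import Literature.Geometry.DiscreteGeometry.TwoShellPatterns

/-!
# Line `distortion-level-cut` — skeleton v1 for crux `PhononSlackCertificates.NearFarGlueR`
(item stmt-AtomisticToContinuum-14970, route route-AtomisticToContinuum-PhononSlackCertificates)

Planner crux-plan seat `planner-cruxplan-stmt-AtomisticToContinuum-14970-distortion-level-cut-0`,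
2026-08-17.  Idea card `Cruxes/NearFarGlueR/Ideas/distortion-level-cut.md` (ideator 2), merged —
as both triagers (TRIAGE-r1-1/2) require — with the ARCHITECTURE of `young-levy-quiet-collar`
(ideator 1): one set of HYBRID BOOKS (zone on reference sites, gross matter as it is), in which

* the first-order interface term is the EXPLICIT flux `Σ_{i∈Z} ⟪x_i − X_i, G_i⟫` (`G_i` = half the
  force on reference site `X_i` in the hybrid configuration) — never a flat `C·#∂Ω`;
* the free boundary of the harmonic zone is SELECTED (level sets of the local non-affinity,
  pigeonhole/FJM patching, RECESSION of the cut away from gross matter until every first-order and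
  slop functional is an `ε`-fraction of the harmonic mass + gross count — `stub_levelCut`, the
  card's lever, honest form of the "amplitude stopping rule");
* the reference is a locally AFFINE(+shuffle) close packing (zero-stress/fitted gauge: the local
  chart `L_i` is within `1/10` of a window similarity, hcp stars carry an internal shuffle `s_i`, so
  the interior reference is force-free and the Cauchy–Born floor `e_CB ≥ e*` is exact: EVERY affine
  Bravais/2-lattice is a periodic configuration);
* what lies beyond the cut is priced EXACTLY: the books are `𝓔(x) − N·e* = [𝓔(x) − 𝓔(R)] +
  [𝓔(R) − N·e*]` with `R` the hybrid reference configuration (zone on reference sites, far side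
  as it is) — the first bracket is Taylor/coercivity (`stub_hybridTaylor`), the second a GLOBAL
  floor (`stub_grossQuanta`, `stub_cauchyBornFloor`) in which no interface deficit, wall or
  lattice continuation is ever claimed, so a cut receded through clean crystal costs nothing.

The crux is FIXED: `NearFarGlueR := FarFieldGapR → NearFieldConvexity → CoerciveTwoShellGap`.
By the landed `nearFarGlueR_iff_stableCore` (…NearFarGlueRStableCoreReduction, c4) it is implied
by the tight contact gap on STABLE CORES (`3/10`-separated, `71/100`-well-bonded,
`1/100`-hole-free, `1/50`-move-stable); `coreGap_of_stubs` proves that from the five stubs by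
linear bookkeeping + counting, and `NearFarGlueR_of` concludes the crux BY NAME.

REGISTERED STUBS (5; every `sorry` of this file is inside one of them):
* `stub_hybridTaylor`   — NF⁺/Taylor: coercive expansion of the near books about the reference,
                           first-order term = the explicit flux (harmonic zone; anharmonic floor).
* `stub_grossQuanta`    — FF⁺: the HYBRID REFERENCE configuration (idealised zone + far side as
                           it is) pays `q` per gross contact above `N·e*`, globally (never
                           pointwise: `Negative/PointwiseContactGap`).
* `stub_cauchyBornFloor` — zero-stress gauge: the hybrid reference pays the charts' affine
                           distortion + shuffle (`e_CB ≥ e*` exactly: affine packings are periodic).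
* `stub_levelCut`       — THE LEVER: selection of an admissible cut with `ε`-small slop and
                           bounded collar / receded-bad counts per gross contact.
* `stub_badStarMass`    — local rigidity of the 19-point star: a 1/20-bad zone particle off the
                           collar carries `κ > 0` of (bond-stretch² + dev² + shuffle² + mismatch²).

`lean check`: rc 0 expected with sorries ONLY in the five `stub_*`; audit: `NearFarGlueR_of`
concludes `Summit.AtomisticToContinuum.Crystallization.Theses.PhononSlackCertificates.NearFarGlueR`.
Companion card: `Lines/distortion-level-cut.md`.
-/

noncomputable section

namespace Summit.AtomisticToContinuum.Crystallization.Cruxes.NearFarGlueR.DistortionLevelCut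

open Literature.MathematicalPhysics.StatisticalMechanics
open Literature.Geometry.DiscreteGeometry
open Summit.AtomisticToContinuum.Crystallization.Theses.PhononSlackCertificates
open scoped BigOperators InnerProductSpace Classical

/-! ## §0 Notation -/

/-- Euclidean 3-space. -/
abbrev E3 := EuclideanSpace ℝ (Fin 3)

/-- `e*` = infimum of the Lennard-Jones energy per particle over periodic configurations. -/
abbrev eStar : ℝ := ⨅ Q : PeriodicConfiguration 3, Q.energyPerParticle lennardJones

/-! ## §1 Native predicates on a configuration -/

/-- STABLE CORE (verbatim the four hypotheses of `nearFarGlueR_iff_stableCore`, c4):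
`3/10`-separated, `71/100`-well-bonded, `1/100`-hole-free, `1/50`-move-stable. -/
def IsCore {N : ℕ} (x : Fin N → E3) : Prop :=
  (∀ i j : Fin N, i ≠ j → (3 / 10 : ℝ) ≤ dist (x i) (x j)) ∧
  (∀ j : Fin N, ∑ k ∈ Finset.univ.erase j,
      (min (lennardJones (dist (x j) (x k))) 0 +
        (1 / 2 : ℝ) * max (lennardJones (dist (x j) (x k))) 0) < -(71 / 100 : ℝ)) ∧
  (∀ p : E3, (∀ i : Fin N, (3 / 10 : ℝ) ≤ dist p (x i)) →
      -(98309653 / 125000000 : ℝ) - 1 / 100 < ∑ i, lennardJones (dist p (x i))) ∧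
  (∀ (j : Fin N) (p : E3), (∀ k : Fin N, k ≠ j → (3 / 10 : ℝ) ≤ dist p (x k)) →
      ∑ k ∈ Finset.univ.erase j, lennardJones (dist (x j) (x k)) - 1 / 50 <
        ∑ k ∈ Finset.univ.erase j, lennardJones (dist p (x k)))

/-- 1/20-bad particle. -/
def Bad {N : ℕ} (x : Fin N → E3) (i : Fin N) : Prop := ¬ IsTwoShellGood (1 / 20) (47 / 50) 1 x i

/-- The WINDOW SIMILARITIES `c • A`, `c ∈ [47/50, 1]`, `A` a linear isometry: the linear charts
of exactly good crystal. -/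
def simSet : Set (E3 →L[ℝ] E3) :=
  {T | ∃ (c : ℝ) (A : E3 →ₗᵢ[ℝ] E3), 47 / 50 ≤ c ∧ c ≤ 1 ∧ T = c • A.toContinuousLinearMap}

/-- Deviatoric/dilational distortion of a local affine chart: operator-norm distance to the window
similarities (zero iff the chart is an exact window similarity). -/
def dev (L : E3 →L[ℝ] E3) : ℝ := Metric.infDist L simSet

/-- Internal shuffle of a pattern point: `0` on the basal plane `v₀ + v₁ + v₂ = 0` of the hcp
integer model (the centre's own sublattice), `s` off it (the other sublattice: the `3 + 3`
off-plane first-shell and all `6` second-shell points of `hcpTwoShellPattern`).  Only used with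
`s = 0` for fcc stars. -/
def shuffleOf (s v : E3) : E3 := if v 0 + v 1 + v 2 = 0 then 0 else s

/-- The affine(+shuffle) image of a two-shell pattern: the 18 reference-star OFFSETS. -/
def starSet (L : E3 →L[ℝ] E3) (s : E3) (P : Finset E3) : Finset E3 :=
  P.image fun v => L v + shuffleOf s v

/-- AFFINELY CHARTABLE particle: its `3/2`-pullback neighbourhood is two-way `1/8`-matched with an
affine(+shuffle) fcc/hcp two-shell star whose linear part is within `1/10` of a window similarity
(shuffle `≤ 1/20`, hcp only).  Every 1/20-good particle is affinely chartable (`L = a • A`,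
`s = 0`).  Particles that are NOT affinely chartable are GROSS. -/
def AffCh {N : ℕ} (x : Fin N → E3) (i : Fin N) : Prop :=
  ∃ (L : E3 →L[ℝ] E3) (s : E3) (P : Finset E3) (f : E3 → Fin N),
    (P = fccTwoShellPattern ∨ P = hcpTwoShellPattern) ∧ (s = 0 ∨ P = hcpTwoShellPattern) ∧
    dev L ≤ 1 / 10 ∧ ‖s‖ ≤ 1 / 20 ∧
    (∀ v ∈ P, f v ≠ i ∧ dist (x (f v)) (x i + L v + shuffleOf s v) ≤ 1 / 8) ∧
    Set.InjOn f ↑P ∧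
    ∀ j : Fin N, j ≠ i → (∃ w : E3, ‖w‖ ≤ 3 / 2 ∧ x j = x i + L w) → ∃ v ∈ P, f v = j

/-- GROSS CONTACTS: gross (= not affinely chartable) particles within distance `2` of an affinely
chartable one — the population charged by the far books (`stub_grossQuanta`).  Cut-independent. -/
def grossContacts {N : ℕ} (x : Fin N → E3) : Finset (Fin N) :=
  Finset.univ.filter fun j => ¬ AffCh x j ∧ ∃ k : Fin N, AffCh x k ∧ dist (x k) (x j) ≤ 2

/-! ## §2 The Lennard-Jones force field (normalisation `V = r⁻¹²/12 − r⁻⁶/6` of the tree) -/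

/-- `V'(r) = −r⁻¹³ + r⁻⁷`. -/
def ljDeriv (r : ℝ) : ℝ := -(r⁻¹) ^ 13 + (r⁻¹) ^ 7

/-- `∇_v V(‖v‖) = V'(‖v‖) v/‖v‖` (junk `0` at `v = 0`, never met: reference sites and particles are
separated in admissible cuts). -/
def ljForce (v : E3) : E3 := (ljDeriv ‖v‖ / ‖v‖) • v

/-! ## §3 Cut data, the hybrid reference and the books -/

/-- The DATA of a cut (no property is smuggled in; admissibility is `Cut.Admissible`, existence of
a good cut is the selection stub `stub_levelCut`):
* `Z` — the harmonic ZONE (affinely chartable particles kept inside the free boundary and booked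
  on reference sites);
* `X` — reference sites (used on `Z`);
* `L`, `s`, `P` — the local affine chart, internal shuffle and pattern (fcc/hcp) at each zone site,
  generating its two-shell reference star `X i + starSet (L i) (s i) (P i)`.
There are no wall/continuation data: the far side is booked EXACTLY through the hybrid reference
configuration `Cut.R` (zone on its sites, everything else as it is), whose energy is floored
globally (`stub_grossQuanta`, `stub_cauchyBornFloor`) — so no interface deficit is ever claimed. -/
structure Cut (N : ℕ) where
  Z : Finset (Fin N)
  X : Fin N → E3
  L : Fin N → (E3 →L[ℝ] E3)
  s : Fin N → E3
  P : Fin N → Finset E3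

namespace Cut

variable {N : ℕ} (C : Cut N) (x : Fin N → E3)

/-- The far side `D = Zᶜ`: gross matter and receded layers, priced exactly (never expanded). -/
def D : Finset (Fin N) := Finset.univ \ C.Z

/-- The HYBRID REFERENCE configuration `R`: zone particles on their reference sites, the far side as
it is.  `𝓔(x) − 𝓔(R)` is the near (Taylor) quantity, `𝓔(R) − N·e*` the far (floor) quantity. -/
def R : Fin N → E3 := fun i => if i ∈ C.Z then C.X i else x i

/-- The reference star of zone site `i` (absolute positions of its 18 star points). -/
def starAt (i : Fin N) : Finset E3 := (starSet (C.L i) (C.s i) (C.P i)).image fun p => C.X i + p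

/-- Misfit of zone particle `i` to its reference site. -/
def u (i : Fin N) : E3 := x i - C.X i

/-- `G_i` = HALF the force field `Σ_{k ≠ i} ∇V(R_i − R_k)` at site `i` of the hybrid reference (so
`2·G_i = ∇_i 𝓔(R)`).  It vanishes at interior sites of an exact, internally relaxed reference and
is supported near the cut, near unrealised star points and where the reference is non-affine. -/
def G (i : Fin N) : E3 := (1 / 2 : ℝ) • ∑ k ∈ Finset.univ.erase i, ljForce (C.R x i - C.R x k)

/-- The FLUX `Σ_{i∈Z} ⟪u_i, G_i⟫`: HALF the exact first-order term of `𝓔(x) − 𝓔(R)` in the misfit. -/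
def flux : ℝ := ∑ i ∈ C.Z, ⟪C.u x i, C.G x i⟫_ℝ

/-- Zone neighbours of site `i` realising its star: within `7/4` of `X i` and within `1/5` of a star
point (admissibility puts every zone site within `7/4` either here or beyond pullback norm `8/5`). -/
def nbrs (i : Fin N) : Finset (Fin N) :=
  (C.Z.erase i).filter fun k => dist (C.X i) (C.X k) ≤ 7 / 4 ∧ Metric.infDist (C.X k) ↑(C.starAt i) ≤ 1 / 5

/-- Zone sites within reference distance `2` of `X i` (two shells and the third). -/
def ball (i : Fin N) : Finset (Fin N) := (C.Z.erase i).filter fun k => dist (C.X i) (C.X k) ≤ 2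

/-- Distance-distortion mass at `i`: `Σ (|x_k − x_l| − |X_k − X_l|)²` over ALL pairs of the cluster
`{i} ∪ ball i` (rotation-invariant, and complete: zero iff the actual cluster is congruent to its
reference cluster; the card's `Σ (Δr)²` made rigid). -/
def massAt (i : Fin N) : ℝ :=
  ∑ k ∈ C.ball i, ∑ l ∈ insert i (C.ball i), (dist (x k) (x l) - dist (C.X k) (C.X l)) ^ 2

/-- Harmonic distance-distortion mass of the zone (each pair counted boundedly often). -/
def mass : ℝ := ∑ i ∈ C.Z, C.massAt x i

/-- Affine distortion mass of the charts (the Cauchy–Born excess is paid from it). -/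
def devSq : ℝ := ∑ i ∈ C.Z, (dev (C.L i)) ^ 2

/-- Shuffle mass of the charts (optical stiffness pays it). -/
def shuffleSq : ℝ := ∑ i ∈ C.Z, ‖C.s i‖ ^ 2

/-- Two-shell star mismatch (non-affinity) of the reference at zone site `i`: total distance of its
star-realising neighbours from the exact star points (zero iff the realised star is exact; every
Barlow stacking is exact with per-site fcc/hcp patterns, so stacking costs nothing here). -/
def nonAffAt (i : Fin N) : ℝ := ∑ k ∈ C.nbrs i, Metric.infDist (C.X k) ↑(C.starAt i)

/-- Quadratic non-affinity of the reference (floor and Hessian slop at non-exact stars). -/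
def nonAffSq : ℝ := ∑ i ∈ C.Z, (C.nonAffAt i) ^ 2

/-- Misfit² × non-affinity (Hessian slop at non-exact stars). -/
def uSqNonAff : ℝ := ∑ i ∈ C.Z, ‖C.u x i‖ ^ 2 * C.nonAffAt i

/-- Cross weight of zone site `i`: `Σ_{j ∈ D} |X_i − x_j|⁻⁶` — dominates every second derivative of
the cross bonds beyond contact (`|V''(r)| ≤ 20·r⁻⁶` for `r ≥ 7/10·…` up to the existential
constant) and decays like (distance to the far side)⁻³. -/
def crossWeight (i : Fin N) : ℝ := ∑ j ∈ C.D, (dist (C.X i) (x j))⁻¹ ^ 6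

/-- Weighted collar misfit mass `Σ_{i∈Z} crossWeight_i·‖u_i‖²` (Hessian slop of the cross bonds;
this replaces any flat `C·#∂Ω`: it is small when the cut has RECEDED into quiet layers). -/
def uSqCross : ℝ := ∑ i ∈ C.Z, C.crossWeight x i * ‖C.u x i‖ ^ 2

/-- The COLLAR (for counting only): zone sites within `2` of a far-side particle, or with an
unrealised star point (facing a vacancy or the vacuum of the reference). -/
def collar : Finset (Fin N) :=
  C.Z.filter fun i => (∃ j ∈ C.D, dist (x j) (C.X i) ≤ 2) ∨
    ∃ p ∈ C.starAt i, ∀ k ∈ C.Z, (1 / 5 : ℝ) < dist (C.X k) p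

/-- Total SLOP of the books: the exact first-order flux in absolute value plus the three quadratic
slop functionals.  The selection stub makes it an `ε`-fraction of harmonic mass + gross count. -/
def slop : ℝ := |C.flux x| + C.uSqCross x + C.nonAffSq + C.uSqNonAff x

/-- Total HARMONIC MASS of the books (what pays the chartable bad particles). -/
def harm : ℝ := C.mass x + C.devSq + C.shuffleSq

/-- ADMISSIBLE cut — purely geometric clauses, none about energies:
reference sites injective on the zone; zone particles affinely chartable; misfit `≤ 1/8`; fcc/hcp
charts within `1/10` of a window similarity, shuffle `≤ 1/20` (hcp only); reference sites of the
zone `9/10`-separated (so every missing reference bond is attractive); LOCAL LATTICE SANITY — a zone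
site within `7/4` of `X i` is within `1/5` of a star point of `i` or lies at pullback norm `≥ 8/5`
(third shell and beyond): no between-shell reference sites; far-side particles keep clearance
`7/10` from zone sites (automatic on cores for chartable zone particles, stated for convenience). -/
def Admissible : Prop :=
  Set.InjOn C.X ↑C.Z ∧
  (∀ i ∈ C.Z, AffCh x i) ∧
  (∀ i ∈ C.Z, dist (x i) (C.X i) ≤ 1 / 8) ∧
  (∀ i ∈ C.Z, (C.P i = fccTwoShellPattern ∨ C.P i = hcpTwoShellPattern) ∧
      (C.s i = 0 ∨ C.P i = hcpTwoShellPattern) ∧ dev (C.L i) ≤ 1 / 10 ∧ ‖C.s i‖ ≤ 1 / 20) ∧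
  (∀ i ∈ C.Z, ∀ k ∈ C.Z, i ≠ k → (9 / 10 : ℝ) ≤ dist (C.X i) (C.X k)) ∧
  (∀ i ∈ C.Z, ∀ k ∈ C.Z, k ≠ i → dist (C.X i) (C.X k) ≤ 7 / 4 →
      Metric.infDist (C.X k) ↑(C.starAt i) ≤ 1 / 5 ∨
        ∃ w : E3, (8 / 5 : ℝ) ≤ ‖w‖ ∧ C.X k = C.X i + C.L i w) ∧
  (∀ i ∈ C.Z, ∀ j ∈ C.D, (7 / 10 : ℝ) ≤ dist (x j) (C.X i))

/-! ### Elementary facts used by the composition -/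

theorem massAt_nonneg (i : Fin N) : 0 ≤ C.massAt x i :=
  Finset.sum_nonneg fun _ _ => Finset.sum_nonneg fun _ _ => sq_nonneg _

theorem mass_nonneg : 0 ≤ C.mass x := Finset.sum_nonneg fun i _ => C.massAt_nonneg x i

theorem devSq_nonneg : 0 ≤ C.devSq := Finset.sum_nonneg fun _ _ => sq_nonneg _

theorem shuffleSq_nonneg : 0 ≤ C.shuffleSq := Finset.sum_nonneg fun _ _ => sq_nonneg _

theorem nonAffAt_nonneg (i : Fin N) : 0 ≤ C.nonAffAt i :=
  Finset.sum_nonneg fun _ _ => Metric.infDist_nonneg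

theorem nonAffSq_nonneg : 0 ≤ C.nonAffSq := Finset.sum_nonneg fun _ _ => sq_nonneg _

theorem crossWeight_nonneg (i : Fin N) : 0 ≤ C.crossWeight x i :=
  Finset.sum_nonneg fun _ _ => pow_nonneg (inv_nonneg.2 dist_nonneg) _

theorem uSqCross_nonneg : 0 ≤ C.uSqCross x :=
  Finset.sum_nonneg fun i _ => mul_nonneg (C.crossWeight_nonneg x i) (sq_nonneg _)

theorem uSqNonAff_nonneg : 0 ≤ C.uSqNonAff x :=
  Finset.sum_nonneg fun i _ => mul_nonneg (sq_nonneg _) (C.nonAffAt_nonneg i)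

theorem harm_nonneg : 0 ≤ C.harm x :=
  add_nonneg (add_nonneg (C.mass_nonneg x) C.devSq_nonneg) C.shuffleSq_nonneg

end Cut

/-! ## §4 The five REGISTERED STUBS -/

/-- **S1 `stub_hybridTaylor` — the harmonic zone (NF⁺ with explicit flux).**  On stable cores and
admissible cuts, `𝓔(x) − 𝓔(R)` (same particles, zone moved from reference sites to actual
positions) dominates its exact first-order term `2·flux` PLUS a coercive share `cQ` of the
distance-distortion mass, up to quadratic slop: cross-bond Hessian terms (`uSqCross`, weights `r⁻⁶`
summed over the far side) and non-exact stars (`nonAffSq`, `uSqNonAff`).  Content: collective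
phonon/elastic coercivity, in the local distance-distortion seminorm and uniformly in zone geometry, of
affinely deformed (≤ 10 %) fcc/hcp Lennard-Jones packings with the far side frozen (all shells in
the Hessian, rigid modes cost nothing on both sides), plus the global anharmonic floor of nn bonds
(`V(r) − V(r₀) − V'(r₀)(r − r₀) ≥ (r − r₀)²/4`, `r₀ ∈ [47/50,1]`, `r ≤ 3/2`; card lemma) in place
of a cubic Taylor remainder for misfits up to `1/8`.  Why it might fail: a soft shear/slip branch
of some admissible chart (10 % shear approaches the ideal shear strain) or third-shell (concave)
bonds out-weighing the two-shell stretch mass in some zone geometry. -/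
theorem stub_hybridTaylor :
    ∃ cQ : ℝ, 0 < cQ ∧ ∃ C₁ : ℝ, 0 ≤ C₁ ∧ ∀ (N : ℕ) (x : Fin N → E3), IsCore x →
      ∀ C : Cut N, C.Admissible x →
        2 * C.flux x + cQ * C.mass x - C₁ * (C.uSqCross x + C.nonAffSq + C.uSqNonAff x) ≤
          interactionEnergy lennardJones x - interactionEnergy lennardJones (C.R x) := by
  sorry

/-- **S2 `stub_grossQuanta` — the far books (FF⁺ in hysteresis form, GLOBAL).**  The hybrid reference
configuration — an idealised (reference-site) zone next to the gross matter and receded layers AS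
THEY ARE — lies above `N·e*` by `q > 0` per GROSS CONTACT of `x` (a particle that is not affinely
chartable within `(dev ≤ 1/10, misfit ≤ 1/8)` and lies within `2` of an affinely chartable one),
up to quadratic non-affinity slop of the reference.  `𝓔(R) ≥ N·e*` itself is free
(periodisation); the content is the quantum: vacancy shells, free-surface layers, intruders and
their shells, occupants displaced `> a/8`, amorphous films and grain-boundary cores next to IDEAL
crystal — `≥ 4·10⁻²` per contact in every family computed (c6 kit j021640; Disproof F3), two orders
above the threshold quantum `1.5·10⁻³` of the near-threshold population, which lives in the zone
and is ABSENT from `R`.  With `Z = ∅` it is the frame-free "gross contact gap"; never pointwise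
(`Negative/PointwiseContactGap`).  Why it might fail: crystal|amorphous ADHESION — a gross film or
grain-boundary core bound to ideal crystal more strongly than its own deficit above `e*`, i.e. a
negative idealised interface energy of order `q` per contact. -/
theorem stub_grossQuanta :
    ∃ q : ℝ, 0 < q ∧ ∃ C₂ : ℝ, 0 ≤ C₂ ∧ ∀ (N : ℕ) (x : Fin N → E3), IsCore x →
      ∀ C : Cut N, C.Admissible x →
        (N : ℝ) * eStar + q * ((grossContacts x).card : ℝ) - C₂ * C.nonAffSq ≤
          interactionEnergy lennardJones (C.R x) := by
  sorry

/-- **S3 `stub_cauchyBornFloor` — zero-stress gauge / Cauchy–Born coercivity of the idealised zone.**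
The hybrid reference configuration lies above `N·e*` by a share `ccb` of the charts' affine
distortion and shuffle mass, up to quadratic non-affinity slop: every affine(+shuffle) fcc/hcp
packing is a PERIODIC configuration, so `e_CB(L, s) ≥ e*` exactly, and
`e_CB(L, s) ≥ e* + ccb·(dist(L, Sim)² + |s|²)` on the admissible chart set by certified relaxed
elastic moduli and optical stiffness of the Lennard-Jones close packings (the input
`NearFieldConvexity` already bets on, here with the boundary term replaced by the exact hybrid
configuration); stacking is invisible (two-shell stars).  Why it might fail: a chart in the
admissible set (up to 10 % strain) where `e_CB` is flat transversally to the similarity orbit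
(incipient Bain/slip path), or a negative idealised interface energy eating the elastic credit. -/
theorem stub_cauchyBornFloor :
    ∃ ccb : ℝ, 0 < ccb ∧ ∃ C₃ : ℝ, 0 ≤ C₃ ∧ ∀ (N : ℕ) (x : Fin N → E3), IsCore x →
      ∀ C : Cut N, C.Admissible x →
        (N : ℝ) * eStar + ccb * (C.devSq + C.shuffleSq) - C₃ * C.nonAffSq ≤
          interactionEnergy lennardJones (C.R x) := by
  sorry

/-- **S4 `stub_levelCut` — THE LEVER: selection of the free boundary.**  For every `ε > 0` there is
`M` such that every stable core admits an admissible cut whose total slop (|flux| + weighted collar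
misfit² + non-affinity² + misfit²·non-affinity) is at most `ε` times (harmonic mass + number of
gross contacts), while the far side holds at most `M` 1/20-bad particles and the collar at most `M`
sites per gross contact.  Mechanism (card + TRIAGE sharpenings): charts FOLLOW the configuration —
local affine fits at the fitted/zero-stress scale with the hcp shuffle relaxed, so the interior
reference is force-free and `G` lives on the collar; level-set/pigeonhole selection of the
patching à la Friesecke–James–Müller keeps the reference smooth where the field is smooth
(non-affinity second order and sparse); near every gross contact the cut RECEDES through quiet
layers until the remaining flux and `r⁻⁶`-weighted collar misfit — which decay with the recession
depth while the gross count does not — are below `ε` per gross contact; receded layers go to the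
far side at NO cost (`R` keeps them as they are).  Finite configurations always have gross contacts
(their surface), so the normalisation never degenerates.  Why it might fail: slop that does not
decay under recession — long-range coherency strain of a misfitting film or inclusion keeps
|flux|/(mass + #gross) bounded below under every admissible re-charting. -/
theorem stub_levelCut :
    ∀ ε : ℝ, 0 < ε → ∃ M : ℝ, 0 ≤ M ∧ ∀ (N : ℕ) (x : Fin N → E3), IsCore x →
      ∃ C : Cut N, C.Admissible x ∧
        C.slop x ≤ ε * (C.harm x + ((grossContacts x).card : ℝ)) ∧
        (((C.D.filter fun j => Bad x j).card : ℝ) ≤ M * ((grossContacts x).card : ℝ)) ∧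
        (((C.collar x).card : ℝ) ≤ M * ((grossContacts x).card : ℝ)) := by
  sorry

/-- **S5 `stub_badStarMass` — charges proportional to the actual distortion, particle by particle.**
A 1/20-BAD zone particle off the collar (so its whole two-shell star is realised by zone particles
and no far-side particle is within `2` of its site) carries a definite amount `κ > 0` of
distance-distortion mass of its reference `2`-ball cluster + chart distortion² + shuffle² + star
mismatch².  If all four vanish the actual cluster is CONGRUENT to an exact similarity star with its
third shell at pullback norm `≥ 8/5 > 3/2` (lattice sanity; hcp's `c`-neighbours sit at `1.633`),
hence the particle is good with margin; `κ` is the modulus of that implication — a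
finite-dimensional (certifiable) computation.  Why it might fail: only through the margins —
`8/5` against `3/2` in the two-way clause, `1/20` in the matching clause — being eaten by a
degenerate hcp-type cluster; then the sanity radius or the pattern set must be adjusted. -/
theorem stub_badStarMass :
    ∃ κ : ℝ, 0 < κ ∧ ∀ (N : ℕ) (x : Fin N → E3), IsCore x → ∀ C : Cut N, C.Admissible x →
      ∀ j ∈ C.Z, j ∉ C.collar x → Bad x j →
        κ ≤ C.massAt x j + (dev (C.L j)) ^ 2 + ‖C.s j‖ ^ 2 + (C.nonAffAt j) ^ 2 := by
  sorry

/-! ## §5 Composition (sorry-free): stubs ⇒ tight contact gap on cores ⇒ the crux BY NAME -/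

set_option maxHeartbeats 1600000 in
/-- The levy, as pure bookkeeping: from the five stub statements, the tight contact gap on stable
cores with an explicit `g₂` built from the stub constants. -/
theorem coreGap_of_stubs :
    ∃ g₂ : ℝ, 0 < g₂ ∧ ∀ (K : ℕ) (z : Fin K → EuclideanSpace ℝ (Fin 3)),
      (∀ i j : Fin K, i ≠ j → (3 / 10 : ℝ) ≤ dist (z i) (z j)) →
      (∀ j : Fin K, ∑ k ∈ Finset.univ.erase j,
        (min (lennardJones (dist (z j) (z k))) 0 +
          (1 / 2 : ℝ) * max (lennardJones (dist (z j) (z k))) 0) < -(71 / 100 : ℝ)) →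
      (∀ p : EuclideanSpace ℝ (Fin 3), (∀ i : Fin K, (3 / 10 : ℝ) ≤ dist p (z i)) →
        -(98309653 / 125000000 : ℝ) - 1 / 100 < ∑ i, lennardJones (dist p (z i))) →
      (∀ (j : Fin K) (p : EuclideanSpace ℝ (Fin 3)), (∀ k : Fin K, k ≠ j → (3 / 10 : ℝ) ≤ dist p (z k)) →
        ∑ k ∈ Finset.univ.erase j, lennardJones (dist (z j) (z k)) - 1 / 50 <
          ∑ k ∈ Finset.univ.erase j, lennardJones (dist p (z k))) →
      (K : ℝ) * (⨅ Q : PeriodicConfiguration 3, Q.energyPerParticle lennardJones)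
        + g₂ * (Nat.card {k : Fin K // ¬ IsTwoShellGood (1 / 20) (47 / 50) 1 z k ∧
            ∃ i : Fin K, IsTwoShellGood (1 / 20) (47 / 50) 1 z i ∧ dist (z i) (z k) ≤ 21 / 20} : ℝ)
        ≤ interactionEnergy lennardJones z := by
  -- constants
  obtain ⟨cQ, hcQ, C₁, hC₁, hS1⟩ := stub_hybridTaylor
  obtain ⟨q, hq, C₂, hC₂, hS2⟩ := stub_grossQuanta
  obtain ⟨ccb, hccb, C₃, hC₃, hS3⟩ := stub_cauchyBornFloor
  obtain ⟨κ, hκ, hS5⟩ := stub_badStarMass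
  obtain ⟨m₀, hm₀⟩ : ∃ m₀ : ℝ, m₀ = min cQ (min (ccb / 2) (q / 2)) := ⟨_, rfl⟩
  have hm₀pos : 0 < m₀ := by rw [hm₀]; exact lt_min hcQ (lt_min (by linarith) (by linarith))
  have hm₀cQ : m₀ ≤ cQ := by rw [hm₀]; exact min_le_left _ _
  have hm₀ccb : m₀ ≤ ccb / 2 := by rw [hm₀]; exact (min_le_right _ _).trans (min_le_left _ _)
  have hm₀q : m₀ ≤ q / 2 := by rw [hm₀]; exact (min_le_right _ _).trans (min_le_right _ _)
  obtain ⟨K₀, hK₀⟩ : ∃ K₀ : ℝ, K₀ = 2 + C₁ + C₂ + C₃ := ⟨_, rfl⟩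
  have hK₀pos : 0 < K₀ := by rw [hK₀]; linarith
  obtain ⟨ε, hε⟩ : ∃ ε : ℝ, ε = m₀ / (2 * K₀) := ⟨_, rfl⟩
  have hεpos : 0 < ε := by rw [hε]; positivity
  have hK₀ε : K₀ * ε = m₀ / 2 := by
    rw [hε]; field_simp
  obtain ⟨M, hM, hS4⟩ := stub_levelCut ε hεpos
  obtain ⟨L₀, hL₀⟩ : ∃ L₀ : ℝ, L₀ = (1 + ε) / κ + ε / κ + 2 * M + 1 := ⟨_, rfl⟩
  have hεκ : 0 ≤ ε / κ := by positivity
  have h1εκ : 0 ≤ (1 + ε) / κ := by positivity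
  have hL₀pos : 0 < L₀ := by rw [hL₀]; positivity
  have hL₀a : (1 + ε) / κ ≤ L₀ := by rw [hL₀]; linarith
  have hL₀b : ε / κ + 2 * M ≤ L₀ := by rw [hL₀]; linarith
  refine ⟨m₀ / (2 * L₀), by positivity, fun K z hsep hwb hhf hms => ?_⟩
  have hcore : IsCore z := ⟨hsep, hwb, hhf, hms⟩
  -- the selected cut and the three book inequalities
  obtain ⟨C, hadm, hslop, hDB, hcol⟩ := hS4 K z hcore
  have h1 := hS1 K z hcore C hadm
  have h2 := hS2 K z hcore C hadm
  have h3 := hS3 K z hcore C hadm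
  -- names and signs
  set GT : ℝ := ((grossContacts z).card : ℝ) with hGT
  have hGT0 : 0 ≤ GT := by rw [hGT]; exact Nat.cast_nonneg _
  have hmass := C.mass_nonneg z
  have hdev := C.devSq_nonneg
  have hsh := C.shuffleSq_nonneg
  have hnaff := C.nonAffSq_nonneg
  have hucr := C.uSqCross_nonneg z
  have hunaff := C.uSqNonAff_nonneg z
  have habsf := abs_nonneg (C.flux z)
  have hharm : C.harm z = C.mass z + C.devSq + C.shuffleSq := rfl
  have hslopdef : C.slop z = |C.flux z| + C.uSqCross z + C.nonAffSq + C.uSqNonAff z := rfl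
  have hflux : -|C.flux z| ≤ C.flux z := neg_abs_le _
  have hfs : |C.flux z| ≤ C.slop z := by rw [hslopdef]; linarith
  have hS₁s : C.uSqCross z + C.nonAffSq + C.uSqNonAff z ≤ C.slop z := by rw [hslopdef]; linarith
  have hnaffslop : C.nonAffSq ≤ C.slop z := by rw [hslopdef]; linarith
  -- (1) the energy side: E − K e* ≥ (m₀/2)·(harm + GT)
  have hprod1 : m₀ * C.mass z ≤ cQ * C.mass z := mul_le_mul_of_nonneg_right hm₀cQ hmass
  have hprod2 : m₀ * (C.devSq + C.shuffleSq) ≤ ccb / 2 * (C.devSq + C.shuffleSq) :=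
    mul_le_mul_of_nonneg_right hm₀ccb (add_nonneg hdev hsh)
  have hprod3 : m₀ * GT ≤ q / 2 * GT := mul_le_mul_of_nonneg_right hm₀q hGT0
  have hprod4 : C₁ * (C.uSqCross z + C.nonAffSq + C.uSqNonAff z) ≤ C₁ * C.slop z :=
    mul_le_mul_of_nonneg_left hS₁s hC₁
  have hprod5 : C₂ * C.nonAffSq ≤ C₂ * C.slop z := mul_le_mul_of_nonneg_left hnaffslop hC₂
  have hprod5' : C₃ * C.nonAffSq ≤ C₃ * C.slop z := mul_le_mul_of_nonneg_left hnaffslop hC₃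
  have hprod6 : K₀ * C.slop z ≤ K₀ * (ε * (C.harm z + GT)) :=
    mul_le_mul_of_nonneg_left hslop hK₀pos.le
  have hslop0 : 0 ≤ C.slop z := by rw [hslopdef]; linarith
  have hC₂s : 0 ≤ C₂ * C.slop z := mul_nonneg hC₂ hslop0
  have hC₃s : 0 ≤ C₃ * C.slop z := mul_nonneg hC₃ hslop0
  have hKS : K₀ * C.slop z = 2 * C.slop z + C₁ * C.slop z + C₂ * C.slop z + C₃ * C.slop z := by
    rw [hK₀]; ring
  have hKE : K₀ * (ε * (C.harm z + GT)) =
      (1 / 2 : ℝ) * (m₀ * C.mass z) + (1 / 2 : ℝ) * (m₀ * (C.devSq + C.shuffleSq)) +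
        (1 / 2 : ℝ) * (m₀ * GT) := by
    have : K₀ * (ε * (C.harm z + GT)) = (K₀ * ε) * (C.harm z + GT) := by ring
    rw [this, hK₀ε, hharm]; ring
  have htarget : m₀ / 2 * (C.harm z + GT) =
      (1 / 2 : ℝ) * (m₀ * C.mass z) + (1 / 2 : ℝ) * (m₀ * (C.devSq + C.shuffleSq)) +
        (1 / 2 : ℝ) * (m₀ * GT) := by rw [hharm]; ring
  have henergy : m₀ / 2 * (C.harm z + GT) ≤
      interactionEnergy lennardJones z - (K : ℝ) * eStar := by
    rw [htarget]
    linarith [h1, h2, h3, hflux, hfs, hprod1, hprod2, hprod3, hprod4, hprod5, hprod5', hprod6,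
      hKS, hKE, hC₂s, hC₃s]
  -- (2) the counting side: #T ≤ L₀·(harm + GT)
  set T : Finset (Fin K) := Finset.univ.filter fun k => ¬ IsTwoShellGood (1 / 20) (47 / 50) 1 z k ∧
      ∃ i : Fin K, IsTwoShellGood (1 / 20) (47 / 50) 1 z i ∧ dist (z i) (z k) ≤ 21 / 20 with hT
  have hTcard : (Nat.card {k : Fin K // ¬ IsTwoShellGood (1 / 20) (47 / 50) 1 z k ∧
      ∃ i : Fin K, IsTwoShellGood (1 / 20) (47 / 50) 1 z i ∧ dist (z i) (z k) ≤ 21 / 20} : ℝ) =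
      (T.card : ℝ) := by
    rw [Nat.card_eq_fintype_card, Fintype.card_subtype]
  set S₀ : Finset (Fin K) := (C.Z \ C.collar z).filter fun j => Bad z j with hS₀
  set DB : Finset (Fin K) := C.D.filter fun j => Bad z j with hDBdef
  have hTsub : T ⊆ S₀ ∪ C.collar z ∪ DB := by
    intro k hk
    rw [hT, Finset.mem_filter] at hk
    have hbad : Bad z k := hk.2.1
    by_cases hkZ : k ∈ C.Z
    · by_cases hkc : k ∈ C.collar z
      · exact Finset.mem_union_left _ (Finset.mem_union_right _ hkc)
      · refine Finset.mem_union_left _ (Finset.mem_union_left _ ?_)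
        rw [hS₀, Finset.mem_filter, Finset.mem_sdiff]
        exact ⟨⟨hkZ, hkc⟩, hbad⟩
    · refine Finset.mem_union_right _ ?_
      simp only [hDBdef, Finset.mem_filter, Cut.D, Finset.mem_sdiff, Finset.mem_univ, true_and]
      exact ⟨hkZ, hbad⟩
  have hTle : (T.card : ℝ) ≤ (S₀.card : ℝ) + ((C.collar z).card : ℝ) + (DB.card : ℝ) := by
    have h := (Finset.card_le_card hTsub).trans
      ((Finset.card_union_le _ _).trans (Nat.add_le_add_right (Finset.card_union_le _ _) _))
    exact_mod_cast h
  -- S5 summed over S₀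
  have hS₀Z : S₀ ⊆ C.Z := by
    intro j hj
    rw [hS₀, Finset.mem_filter, Finset.mem_sdiff] at hj
    exact hj.1.1
  have hS₀sum : (S₀.card : ℝ) * κ ≤
      ∑ j ∈ S₀, (C.massAt z j + (dev (C.L j)) ^ 2 + ‖C.s j‖ ^ 2 + (C.nonAffAt j) ^ 2) := by
    have h := Finset.card_nsmul_le_sum S₀
      (fun j => C.massAt z j + (dev (C.L j)) ^ 2 + ‖C.s j‖ ^ 2 + (C.nonAffAt j) ^ 2) κ
      (fun j hj => by
        rw [hS₀, Finset.mem_filter, Finset.mem_sdiff] at hj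
        exact hS5 K z hcore C hadm j hj.1.1 hj.1.2 hj.2)
    rwa [nsmul_eq_mul] at h
  have hsumZ : ∑ j ∈ S₀, (C.massAt z j + (dev (C.L j)) ^ 2 + ‖C.s j‖ ^ 2 + (C.nonAffAt j) ^ 2) ≤
      ∑ j ∈ C.Z, (C.massAt z j + (dev (C.L j)) ^ 2 + ‖C.s j‖ ^ 2 + (C.nonAffAt j) ^ 2) :=
    Finset.sum_le_sum_of_subset_of_nonneg hS₀Z fun j _ _ =>
      add_nonneg (add_nonneg (add_nonneg (C.massAt_nonneg z j) (sq_nonneg _)) (sq_nonneg _))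
        (sq_nonneg _)
  have hsumZeq : ∑ j ∈ C.Z, (C.massAt z j + (dev (C.L j)) ^ 2 + ‖C.s j‖ ^ 2 + (C.nonAffAt j) ^ 2) =
      C.mass z + C.devSq + C.shuffleSq + C.nonAffSq := by
    simp only [Cut.mass, Cut.devSq, Cut.shuffleSq, Cut.nonAffSq, Finset.sum_add_distrib]
  have hεsplit : ε * (C.harm z + GT) = ε * C.harm z + ε * GT := by ring
  have hS₀le : (S₀.card : ℝ) * κ ≤ (1 + ε) * C.harm z + ε * GT := by
    have hh := hS₀sum.trans (hsumZ.trans hsumZeq.le)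
    have h1ε : (1 + ε) * C.harm z = C.harm z + ε * C.harm z := by ring
    rw [h1ε, hharm]
    rw [hharm] at hslop hεsplit
    linarith [hh, hnaffslop, hslop, hεsplit]
  have hS₀card : (S₀.card : ℝ) ≤ ((1 + ε) * C.harm z + ε * GT) / κ := by
    rw [le_div_iff₀ hκ]; exact hS₀le
  have hcount : (T.card : ℝ) ≤ L₀ * (C.harm z + GT) := by
    have hh : 0 ≤ C.harm z := C.harm_nonneg z
    have hcolle : ((C.collar z).card : ℝ) ≤ M * GT := hcol
    have hDBle : (DB.card : ℝ) ≤ M * GT := hDB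
    have step : (T.card : ℝ) ≤ ((1 + ε) * C.harm z + ε * GT) / κ + M * GT + M * GT := by linarith
    have hsplit : ((1 + ε) * C.harm z + ε * GT) / κ = (1 + ε) / κ * C.harm z + ε / κ * GT := by
      field_simp
    rw [hsplit] at step
    have e1 : (1 + ε) / κ * C.harm z ≤ L₀ * C.harm z := mul_le_mul_of_nonneg_right hL₀a hh
    have e2 : (ε / κ + 2 * M) * GT ≤ L₀ * GT := mul_le_mul_of_nonneg_right hL₀b hGT0
    have e3 : (ε / κ + 2 * M) * GT = ε / κ * GT + M * GT + M * GT := by ring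
    have e4 : L₀ * (C.harm z + GT) = L₀ * C.harm z + L₀ * GT := by ring
    linarith [step, e1, e2, e3, e4]
  -- (3) assemble
  rw [hTcard]
  have hfin : m₀ / (2 * L₀) * (T.card : ℝ) ≤ m₀ / 2 * (C.harm z + GT) := by
    have hc := mul_le_mul_of_nonneg_left hcount (show 0 ≤ m₀ / (2 * L₀) by positivity)
    have he : m₀ / (2 * L₀) * (L₀ * (C.harm z + GT)) = m₀ / 2 * (C.harm z + GT) := by
      field_simp
    linarith [hc, he]
  have hen := henergy
  simp only [eStar] at hen
  linarith

/-- **The crux, BY NAME.**  `NearFarGlueR` from the five stubs: the core gap (`coreGap_of_stubs`)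
through the landed `nearFarGlueR_iff_stableCore` (c4); both antecedents of the crux are discarded
(they are theorems on thin sets, Disproof F1), as every line for this crux must. -/
theorem NearFarGlueR_of : NearFarGlueR :=
  Theorems.PhononSlackCertificatesNearFarGlueR.nearFarGlueR_iff_stableCore.2
    fun _ _ => coreGap_of_stubs

end Summit.AtomisticToContinuum.Crystallization.Cruxes.NearFarGlueR.DistortionLevelCut

end
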